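import Summits.NavierStokesRegularity.NavierStokesRegularity.Theses.RellichScar
import Summits.NavierStokesRegularity.NavierStokesRegularity.Theorems.ScarRigidity.Negative.LogicAndLoadBearing
import Literature.Analysis.FluidPDE.TypeIAncientMild
import Literature.Analysis.FluidPDE.ParasiticSlabFlow
import Summits.NavierStokesRegularity.NavierStokesRegularity.Theorems.SqueezeCycleExtremalElementExistsRegularity
import Summits.NavierStokesRegularity.NavierStokesRegularity.Theorems.SqueezeCycleExtremalElementExistsRescale
import Literature.Analysis.FluidPDE.KNSSLocalSmoothingHolds
import HarnessLib

/-!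
# `ScarRigidity` — line `finite-energy-log-convexity`, stub `stub_apexDerivativeBounds`:
# the parabolic-core bounds (crux stmt-NavierStokesRegularity-11717, route RellichScar)

Helper file for S1β (`stub_apexDerivativeBounds`). For a Type-I ancient mild field `V` in the
Oseen/KNSS gauge (`IsTypeIAncientMild C V`: jointly smooth on the open slab `t < 0`, divergence
free, Oseen–Duhamel formula between all pairs of negative times, `‖V‖ ≤ C/√(-t)`) the smoothing
estimates of Koch–Nadirashvili–Seregin–Šverák 2009, Prop. 4.1 / (4.10)–(4.11), in the tree's
uniform-over-the-class rendering (`exists_norm_iteratedFDeriv_le_of_typeI`,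
`exists_lipschitz_time_of_typeI`, route `SqueezeCycle`), bound every spatial derivative and the
time derivative at the time `t = -1` by constants depending on `C` only. The class is invariant
under the Navier–Stokes zoom `V ↦ c V(c² ·, c ·)` (`isTypeIAncientMild_zoom`), and zooming with
`c = √(-t)` turns the bounds at `t = -1` into the **scale-invariant core bounds**

  `‖Dᵏ V(t)(x)‖ ≤ K_k / √(-t)^{k+1}`,  `‖∂ₜ V(t, x)‖ ≤ K / √(-t)³`  (`t < 0`, all `x`),

uniformly over the class. In the parabolic core `‖x‖ ≤ √(-t)` these are the bounds
`L/(‖x‖ + √(-t))^{k+1}` of S1β (`core_le_apex_weight`).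
-/

noncomputable section

open Set Filter Function MeasureTheory Metric TopologicalSpace
open scoped Topology ENNReal NNReal InnerProductSpace RealInnerProductSpace
open Literature.Analysis.FluidPDE
open Summit.NavierStokesRegularity.NavierStokesRegularity.Theses.RellichScar
open Summit.NavierStokesRegularity.NavierStokesRegularity.Theorems.ScarRigidity.Negative

set_option linter.dupNamespace false

namespace Summit.NavierStokesRegularity.NavierStokesRegularity.Theorems.RellichScarScarRigidity

open Literature.Analysis

/-! ## Uniform bounds at the unit time `t = -1` -/

/-- **All spatial derivatives at `t = -1` are bounded uniformly over the class**
`IsTypeIAncientMild C` (KNSS 2009, (4.10), through `exists_norm_iteratedFDeriv_le_of_typeI` on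
the window `(-2, -1/2)` with margin `1/2`). [cite: KochNadirashviliSereginSverak2009, §4 (4.10) with Prop. 4.1 (arXiv:0709.3599v1 p. 8)] -/
theorem exists_norm_iteratedFDeriv_le_neg_one (C : ℝ) (k : ℕ) :
    ∃ K : ℝ, 0 ≤ K ∧ ∀ ⦃V : ℝ → (EuclideanSpace ℝ (Fin 3)) → (EuclideanSpace ℝ (Fin 3))⦄, IsTypeIAncientMild C V →
      ∀ x : (EuclideanSpace ℝ (Fin 3)), ‖iteratedFDeriv ℝ k (V (-1)) x‖ ≤ K := by
  obtain ⟨K, hK⟩ := exists_norm_iteratedFDeriv_le_of_typeI C k (a := -2) (b := -1 / 2)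
    (δ := 1 / 2) (by norm_num) (by norm_num) (by norm_num)
  refine ⟨max K 0, le_max_right _ _, fun V hV x => ?_⟩
  have h := hK hV.continuousOn_uncurry (fun t ht => hV.isWeaklyDivFree ht)
    (fun s t hst ht x => hV.mild_eq_heatExtension hst ht x) hV.hasTypeITimeDecay (-1)
    ⟨by norm_num, by norm_num⟩ x
  exact h.trans (le_max_left _ _)

/-- **The time derivative at `t = -1` is bounded uniformly over the class**
`IsTypeIAncientMild C` (KNSS 2009, (4.11): the slices are Lipschitz in time on the window
`(-2, -1/2)`, `exists_lipschitz_time_of_typeI` with `k = 0`, and a Lipschitz bound near `-1`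
bounds the derivative, `norm_deriv_le_of_lip'`). [cite: KochNadirashviliSereginSverak2009, §4 (4.11) (arXiv:0709.3599v1 p. 8)] -/
theorem exists_norm_deriv_le_neg_one (C : ℝ) :
    ∃ L : ℝ, 0 ≤ L ∧ ∀ ⦃V : ℝ → (EuclideanSpace ℝ (Fin 3)) → (EuclideanSpace ℝ (Fin 3))⦄, IsTypeIAncientMild C V →
      ∀ x : (EuclideanSpace ℝ (Fin 3)), ‖deriv (fun s => V s x) (-1)‖ ≤ L := by
  obtain ⟨L, hL0, hL⟩ := exists_lipschitz_time_of_typeI C 0 (a := -2) (b := -1 / 2)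
    (δ := 1 / 2) (by norm_num) (by norm_num) (by norm_num)
  refine ⟨L, hL0, fun V hV x => ?_⟩
  have hLip := hL hV.continuousOn_uncurry (fun t ht => hV.isWeaklyDivFree ht)
    (fun s t hst ht x => hV.mild_eq_heatExtension hst ht x) hV.hasTypeITimeDecay
  refine norm_deriv_le_of_lip' hL0 ?_
  have hnhds : Ioo (-3 / 2 : ℝ) (-1 / 2) ∈ 𝓝 (-1 : ℝ) := Ioo_mem_nhds (by norm_num) (by norm_num)
  filter_upwards [hnhds] with s hs
  have h := hLip (-1) ⟨by norm_num, by norm_num⟩ s ⟨by linarith [hs.1], hs.2⟩ x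
  -- `‖D⁰f x - D⁰g x‖ = ‖f x - g x‖`
  have e : ‖iteratedFDeriv ℝ 0 (V s) x - iteratedFDeriv ℝ 0 (V (-1)) x‖ = ‖V s x - V (-1) x‖ := by
    simp only [iteratedFDeriv_zero_eq_comp, comp_apply, ← map_sub, LinearIsometryEquiv.norm_map]
  rw [e] at h
  simpa only [Real.norm_eq_abs, sub_neg_eq_add] using h

/-! ## The zoom to the unit time -/

section Zoom

variable {C : ℝ} {V : ℝ → (EuclideanSpace ℝ (Fin 3)) → (EuclideanSpace ℝ (Fin 3))}

/-- The zoom `W(s, y) = c V(c² s, c y)` with `c = √(-t)` recovers the slice `V t` from the unit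
slice `W(-1)`: `V t x = c⁻¹ W(-1)(c⁻¹ x)` (`c² · (-1) = t`). [folklore] -/
theorem slice_eq_zoom_neg_one {t : ℝ} (ht : t < 0) (x : (EuclideanSpace ℝ (Fin 3))) :
    V t x = (Real.sqrt (-t))⁻¹ •
      (Real.sqrt (-t) • stPull (Real.sqrt (-t) ^ 2) (Real.sqrt (-t)) 0 0 V) (-1)
        ((Real.sqrt (-t))⁻¹ • x) := by
  have hc : 0 < Real.sqrt (-t) := Real.sqrt_pos.2 (neg_pos.2 ht)
  rw [zoom_apply, smul_smul, inv_mul_cancel₀ hc.ne', one_smul, zero_add, smul_smul,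
    mul_inv_cancel₀ hc.ne', one_smul, Real.sq_sqrt (neg_pos.2 ht).le]
  congr 1
  ring

/-- The slice `V t` as a function: `V t = c⁻¹ • W(-1) ∘ (c⁻¹ • ·)`, `c = √(-t)`. [folklore] -/
theorem slice_eq_zoom_neg_one_fun {t : ℝ} (ht : t < 0) :
    V t = fun x => (Real.sqrt (-t))⁻¹ •
      (Real.sqrt (-t) • stPull (Real.sqrt (-t) ^ 2) (Real.sqrt (-t)) 0 0 V) (-1)
        ((Real.sqrt (-t))⁻¹ • x) :=
  funext fun x => slice_eq_zoom_neg_one ht x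

/-- A time line of `V` through the zoom: `V s x = c⁻¹ W(c⁻² s)(c⁻¹ x)`, `c = √(-t)`, for every
`s` (pure algebra of the pull-back). [folklore] -/
theorem line_eq_zoom {t : ℝ} (ht : t < 0) (x : (EuclideanSpace ℝ (Fin 3))) (s : ℝ) :
    V s x = (Real.sqrt (-t))⁻¹ •
      (Real.sqrt (-t) • stPull (Real.sqrt (-t) ^ 2) (Real.sqrt (-t)) 0 0 V)
        ((Real.sqrt (-t) ^ 2)⁻¹ * s) ((Real.sqrt (-t))⁻¹ • x) := by
  have hc : 0 < Real.sqrt (-t) := Real.sqrt_pos.2 (neg_pos.2 ht)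
  have hc2 : Real.sqrt (-t) ^ 2 ≠ 0 := pow_ne_zero 2 hc.ne'
  rw [zoom_apply, smul_smul, inv_mul_cancel₀ hc.ne', one_smul, zero_add, smul_smul,
    mul_inv_cancel₀ hc.ne', one_smul, ← mul_assoc, mul_inv_cancel₀ hc2, one_mul]

/-- **Scaling of spatial derivatives**: `‖Dᵏ V(t)(x)‖ ≤ c^{-(k+1)} ‖Dᵏ W(-1)(c⁻¹x)‖` with
`c = √(-t)` and `W` the zoom (chain rule for the homothety, `norm_iteratedFDeriv_comp_smul_le`).
[folklore] -/
theorem norm_iteratedFDeriv_slice_le_zoom {t : ℝ} (ht : t < 0) (k : ℕ) (x : (EuclideanSpace ℝ (Fin 3))) :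
    ‖iteratedFDeriv ℝ k (V t) x‖ ≤ ((Real.sqrt (-t))⁻¹) ^ (k + 1) *
      ‖iteratedFDeriv ℝ k
        ((Real.sqrt (-t) • stPull (Real.sqrt (-t) ^ 2) (Real.sqrt (-t)) 0 0 V) (-1))
        ((Real.sqrt (-t))⁻¹ • x)‖ := by
  have hc : 0 < Real.sqrt (-t) := Real.sqrt_pos.2 (neg_pos.2 ht)
  have hci : 0 < (Real.sqrt (-t))⁻¹ := inv_pos.2 hc
  set W := (Real.sqrt (-t) • stPull (Real.sqrt (-t) ^ 2) (Real.sqrt (-t)) 0 0 V) (-1) with hW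
  rw [slice_eq_zoom_neg_one_fun (V := V) ht]
  have h1 : iteratedFDeriv ℝ k (fun x => (Real.sqrt (-t))⁻¹ • W ((Real.sqrt (-t))⁻¹ • x)) x =
      (Real.sqrt (-t))⁻¹ • iteratedFDeriv ℝ k (fun x => W ((Real.sqrt (-t))⁻¹ • x)) x := by
    rw [iteratedFDeriv_const_smul_real (fun x => W ((Real.sqrt (-t))⁻¹ • x)) (Real.sqrt (-t))⁻¹ k]
  rw [← hW, h1, norm_smul, Real.norm_of_nonneg hci.le, pow_succ, mul_comm _ ((Real.sqrt (-t))⁻¹),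
    mul_assoc]
  refine mul_le_mul_of_nonneg_left ?_ hci.le
  have h2 := norm_iteratedFDeriv_comp_smul_le W hci.ne' k x
  rwa [abs_of_pos hci] at h2

/-- **Scaling of the time derivative**: `∂ₛ V(s, x)|_{s=t} = c⁻³ ∂_σ W(σ, c⁻¹x)|_{σ=-1}`,
`c = √(-t)` (chain rule for `σ = c⁻² s`). [folklore] -/
theorem deriv_line_eq_zoom {t : ℝ} (ht : t < 0) (x : (EuclideanSpace ℝ (Fin 3))) :
    deriv (fun s => V s x) t = ((Real.sqrt (-t))⁻¹) ^ 3 •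
      deriv (fun σ => (Real.sqrt (-t) • stPull (Real.sqrt (-t) ^ 2) (Real.sqrt (-t)) 0 0 V) σ
        ((Real.sqrt (-t))⁻¹ • x)) (-1) := by
  have hc : 0 < Real.sqrt (-t) := Real.sqrt_pos.2 (neg_pos.2 ht)
  have hc2 : Real.sqrt (-t) ^ 2 = -t := Real.sq_sqrt (neg_pos.2 ht).le
  set W := Real.sqrt (-t) • stPull (Real.sqrt (-t) ^ 2) (Real.sqrt (-t)) 0 0 V with hW
  set g : ℝ → (EuclideanSpace ℝ (Fin 3)) := fun σ => W σ ((Real.sqrt (-t))⁻¹ • x) with hg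
  have hline : (fun s => V s x) = fun s => (Real.sqrt (-t))⁻¹ • g ((Real.sqrt (-t) ^ 2)⁻¹ * s) := by
    funext s
    rw [hg, hW]
    exact line_eq_zoom ht x s
  rw [hline, deriv_fun_const_smul_field,
    deriv_comp_mul_left ((Real.sqrt (-t) ^ 2)⁻¹) g t, smul_smul]
  have harg : (Real.sqrt (-t) ^ 2)⁻¹ * t = -1 := by
    rw [hc2, inv_mul_eq_div, div_neg, div_self ht.ne]
  rw [harg]
  congr 1
  rw [inv_pow, ← mul_inv]
  congr 1
  ring

end Zoom

/-! ## The scale-invariant core bounds -/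

/-- **Scale-invariant bound for all spatial derivatives**, uniformly over the class: for every
order `k` there is `K ≥ 0` with `‖Dᵏ V(t)(x)‖ ≤ K / √(-t)^{k+1}` for all `t < 0`, all `x`, and
all `V` with `IsTypeIAncientMild C V` (the bound at `t = -1` transported by the zoom with
`c = √(-t)`; KNSS 2009, Prop. 4.1 and §1 (1.2)). [cite: KochNadirashviliSereginSverak2009, Prop. 4.1 (4.6), (4.10) and §1 (1.2) (arXiv:0709.3599v1 pp. 2, 8)] -/
theorem exists_norm_iteratedFDeriv_le_core (C : ℝ) (k : ℕ) :
    ∃ K : ℝ, 0 ≤ K ∧ ∀ ⦃V : ℝ → (EuclideanSpace ℝ (Fin 3)) → (EuclideanSpace ℝ (Fin 3))⦄, IsTypeIAncientMild C V →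
      ∀ t < 0, ∀ x : (EuclideanSpace ℝ (Fin 3)), ‖iteratedFDeriv ℝ k (V t) x‖ ≤ K / Real.sqrt (-t) ^ (k + 1) := by
  obtain ⟨K, hK0, hK⟩ := exists_norm_iteratedFDeriv_le_neg_one C k
  refine ⟨K, hK0, fun V hV t ht x => ?_⟩
  have hc : 0 < Real.sqrt (-t) := Real.sqrt_pos.2 (neg_pos.2 ht)
  have hW := isTypeIAncientMild_zoom hV hc (0 : (EuclideanSpace ℝ (Fin 3)))
  refine (norm_iteratedFDeriv_slice_le_zoom ht k x).trans ?_
  rw [inv_pow, ← div_eq_inv_mul]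
  exact div_le_div_of_nonneg_right (hK hW _) (pow_nonneg hc.le _)

/-- **Scale-invariant bound for the velocity gradient**: `‖∇V(t)(x)‖ ≤ K / (-t)` on the slab,
uniformly over the class. [cite: KochNadirashviliSereginSverak2009, Prop. 4.1 (4.6) (arXiv:0709.3599v1 p. 8)] -/
theorem exists_norm_fderiv_le_core (C : ℝ) :
    ∃ K : ℝ, 0 ≤ K ∧ ∀ ⦃V : ℝ → (EuclideanSpace ℝ (Fin 3)) → (EuclideanSpace ℝ (Fin 3))⦄, IsTypeIAncientMild C V →
      ∀ t < 0, ∀ x : (EuclideanSpace ℝ (Fin 3)), ‖fderiv ℝ (V t) x‖ ≤ K / (-t) := by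
  obtain ⟨K, hK0, hK⟩ := exists_norm_iteratedFDeriv_le_core C 1
  refine ⟨K, hK0, fun V hV t ht x => ?_⟩
  have h := hK hV t ht x
  have h2 : Real.sqrt (-t) ^ (1 + 1) = -t := Real.sq_sqrt (neg_pos.2 ht).le
  rwa [norm_iteratedFDeriv_one, h2] at h

/-- **Scale-invariant bound for the velocity Hessian**: `‖D²V(t)(x)‖ ≤ K / ((-t) √(-t))` on
the slab, uniformly over the class. [cite: KochNadirashviliSereginSverak2009, Prop. 4.1 (4.6) (arXiv:0709.3599v1 p. 8)] -/
theorem exists_norm_iteratedFDeriv_two_le_core (C : ℝ) :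
    ∃ K : ℝ, 0 ≤ K ∧ ∀ ⦃V : ℝ → (EuclideanSpace ℝ (Fin 3)) → (EuclideanSpace ℝ (Fin 3))⦄, IsTypeIAncientMild C V →
      ∀ t < 0, ∀ x : (EuclideanSpace ℝ (Fin 3)), ‖iteratedFDeriv ℝ 2 (V t) x‖ ≤ K / ((-t) * Real.sqrt (-t)) := by
  obtain ⟨K, hK0, hK⟩ := exists_norm_iteratedFDeriv_le_core C 2
  refine ⟨K, hK0, fun V hV t ht x => ?_⟩
  have h := hK hV t ht x
  have h3 : Real.sqrt (-t) ^ (2 + 1) = (-t) * Real.sqrt (-t) := by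
    rw [pow_succ, Real.sq_sqrt (neg_pos.2 ht).le]
  rwa [h3] at h

/-- **Scale-invariant bound for the time derivative**: `‖∂ₜV(t, x)‖ ≤ K / ((-t) √(-t))` on the
slab, uniformly over the class (the bound at `t = -1` transported by the zoom; KNSS 2009,
(4.11) and §1 (1.2)). [cite: KochNadirashviliSereginSverak2009, §4 (4.11) and §1 (1.2) (arXiv:0709.3599v1 pp. 2, 8)] -/
theorem exists_norm_deriv_le_core (C : ℝ) :
    ∃ K : ℝ, 0 ≤ K ∧ ∀ ⦃V : ℝ → (EuclideanSpace ℝ (Fin 3)) → (EuclideanSpace ℝ (Fin 3))⦄, IsTypeIAncientMild C V →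
      ∀ t < 0, ∀ x : (EuclideanSpace ℝ (Fin 3)), ‖deriv (fun s => V s x) t‖ ≤ K / ((-t) * Real.sqrt (-t)) := by
  obtain ⟨K, hK0, hK⟩ := exists_norm_deriv_le_neg_one C
  refine ⟨K, hK0, fun V hV t ht x => ?_⟩
  have hc : 0 < Real.sqrt (-t) := Real.sqrt_pos.2 (neg_pos.2 ht)
  have hW := isTypeIAncientMild_zoom hV hc (0 : (EuclideanSpace ℝ (Fin 3)))
  have h3 : Real.sqrt (-t) ^ 3 = (-t) * Real.sqrt (-t) := by
    rw [pow_succ, Real.sq_sqrt (neg_pos.2 ht).le]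
  rw [deriv_line_eq_zoom ht x, norm_smul, norm_pow, norm_inv, Real.norm_of_nonneg hc.le,
    inv_pow, ← div_eq_inv_mul, h3]
  exact div_le_div_of_nonneg_right (hK hW _) (mul_nonneg (neg_pos.2 ht).le hc.le)

/-! ## From core bounds to the apex weights -/

/-- In the parabolic core `‖x‖ ≤ A √(-t)` the weight `(‖x‖ + √(-t))^n` is at most
`(A + 1)^n √(-t)^n`, so a core bound `K/√(-t)^n` is an apex bound `(A+1)^n K/(‖x‖ + √(-t))^n`.
[folklore] -/
theorem core_le_apex_weight {A K t : ℝ} (hK : 0 ≤ K) (ht : t < 0) (n : ℕ) {x : (EuclideanSpace ℝ (Fin 3))}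
    (hx : ‖x‖ ≤ A * Real.sqrt (-t)) :
    K / Real.sqrt (-t) ^ n ≤ (A + 1) ^ n * K / (‖x‖ + Real.sqrt (-t)) ^ n := by
  have hc : 0 < Real.sqrt (-t) := Real.sqrt_pos.2 (neg_pos.2 ht)
  have hden : 0 < ‖x‖ + Real.sqrt (-t) := add_pos_of_nonneg_of_pos (norm_nonneg _) hc
  have hle : ‖x‖ + Real.sqrt (-t) ≤ (A + 1) * Real.sqrt (-t) := by linarith
  rw [div_le_div_iff₀ (pow_pos hc n) (pow_pos hden n)]
  calc K * (‖x‖ + Real.sqrt (-t)) ^ n ≤ K * ((A + 1) * Real.sqrt (-t)) ^ n :=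
        mul_le_mul_of_nonneg_left (pow_le_pow_left₀ hden.le hle n) hK
    _ = (A + 1) ^ n * K * Real.sqrt (-t) ^ n := by rw [mul_pow]; ring

/-! ## Merging the core and far bounds into the apex weights -/

/-- Merging a core bound `A/√(-t)^m` and a far bound `B/‖x‖^m` into the apex weight:
`min ≤ 2^m (A + B)/(‖x‖ + √(-t))^m` (use the far bound when `√(-t) ≤ ‖x‖`, the core bound
otherwise). [folklore] -/
theorem le_apex_weight_of_core_of_far {A B t : ℝ} (hA : 0 ≤ A) (hB : 0 ≤ B) (ht : t < 0)
    (m : ℕ) {x : (EuclideanSpace ℝ (Fin 3))} {X : ℝ} (hcore : X ≤ A / Real.sqrt (-t) ^ m)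
    (hfar : x ≠ 0 → X ≤ B / ‖x‖ ^ m) :
    X ≤ 2 ^ m * (A + B) / (‖x‖ + Real.sqrt (-t)) ^ m := by
  have hc : 0 < Real.sqrt (-t) := Real.sqrt_pos.2 (neg_pos.2 ht)
  have hden : 0 < ‖x‖ + Real.sqrt (-t) := add_pos_of_nonneg_of_pos (norm_nonneg _) hc
  rcases le_or_gt ‖x‖ (Real.sqrt (-t)) with hx | hx
  · -- core
    refine hcore.trans ?_
    rw [div_le_div_iff₀ (pow_pos hc m) (pow_pos hden m)]
    have hle : ‖x‖ + Real.sqrt (-t) ≤ 2 * Real.sqrt (-t) := by linarith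
    calc A * (‖x‖ + Real.sqrt (-t)) ^ m ≤ A * (2 * Real.sqrt (-t)) ^ m :=
          mul_le_mul_of_nonneg_left (pow_le_pow_left₀ hden.le hle m) hA
      _ = 2 ^ m * A * Real.sqrt (-t) ^ m := by rw [mul_pow]; ring
      _ ≤ 2 ^ m * (A + B) * Real.sqrt (-t) ^ m := by gcongr; linarith
  · -- far
    have hx0 : x ≠ 0 := by
      intro h; rw [h, norm_zero] at hx; linarith [hc]
    have hxn : 0 < ‖x‖ := norm_pos_iff.2 hx0
    refine (hfar hx0).trans ?_
    rw [div_le_div_iff₀ (pow_pos hxn m) (pow_pos hden m)]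
    have hle : ‖x‖ + Real.sqrt (-t) ≤ 2 * ‖x‖ := by linarith
    calc B * (‖x‖ + Real.sqrt (-t)) ^ m ≤ B * (2 * ‖x‖) ^ m :=
          mul_le_mul_of_nonneg_left (pow_le_pow_left₀ hden.le hle m) hB
      _ = 2 ^ m * B * ‖x‖ ^ m := by rw [mul_pow]; ring
      _ ≤ 2 ^ m * (A + B) * ‖x‖ ^ m := by gcongr; linarith

/-! ## Registered sub-goal (helper stub of `stub_apexDerivativeBounds`) -/

/-- **Registered helper stub `stub_apexCoreBounds`** (sub-goal of `stub_apexDerivativeBounds`,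
crux stmt-NavierStokesRegularity-11717): the scale-invariant parabolic-core bounds for Type-I
ancient mild fields in the Oseen gauge — one constant `K = K(C)` with `‖∇V(t)(x)‖ ≤ K/(-t)`,
`‖D²V(t)(x)‖ ≤ K/((-t)√(-t))`, `‖∂ₜV(t,x)‖ ≤ K/((-t)√(-t))` for all `t < 0`, all `x`, and all `V`
with `IsTypeIAncientMild C V` (KNSS 2009, Prop. 4.1 / (4.10)–(4.11) at `t = -1`, transported by
the scaling (1.2)). [cite: KochNadirashviliSereginSverak2009, Prop. 4.1, (4.10)–(4.11) and §1 (1.2) (arXiv:0709.3599v1 pp. 2, 8)] -/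
theorem stub_apexCoreBounds :
    ∀ C : ℝ, ∃ K : ℝ, 0 ≤ K ∧
      ∀ (V : ℝ → EuclideanSpace ℝ (Fin 3) → EuclideanSpace ℝ (Fin 3)), IsTypeIAncientMild C V →
        ∀ t < 0, ∀ x : EuclideanSpace ℝ (Fin 3),
          ‖fderiv ℝ (V t) x‖ ≤ K / (-t) ∧
          ‖iteratedFDeriv ℝ 2 (V t) x‖ ≤ K / ((-t) * Real.sqrt (-t)) ∧
          ‖deriv (fun s => V s x) t‖ ≤ K / ((-t) * Real.sqrt (-t)) := by
  intro C
  obtain ⟨K₁, hK₁0, hK₁⟩ := exists_norm_fderiv_le_core C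
  obtain ⟨K₂, hK₂0, hK₂⟩ := exists_norm_iteratedFDeriv_two_le_core C
  obtain ⟨K₃, hK₃0, hK₃⟩ := exists_norm_deriv_le_core C
  refine ⟨max K₁ (max K₂ K₃), le_max_of_le_left hK₁0, fun V hV t ht x => ⟨?_, ?_, ?_⟩⟩
  · exact (hK₁ hV t ht x).trans (div_le_div_of_nonneg_right (le_max_left _ _) (neg_pos.2 ht).le)
  · refine (hK₂ hV t ht x).trans (div_le_div_of_nonneg_right ?_ ?_)
    · exact (le_max_left _ _).trans (le_max_right _ _)
    · exact mul_nonneg (neg_pos.2 ht).le (Real.sqrt_nonneg _)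
  · refine (hK₃ hV t ht x).trans (div_le_div_of_nonneg_right ?_ ?_)
    · exact (le_max_right _ _).trans (le_max_right _ _)
    · exact mul_nonneg (neg_pos.2 ht).le (Real.sqrt_nonneg _)

end Summit.NavierStokesRegularity.NavierStokesRegularity.Theorems.RellichScarScarRigidity

end
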